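import Summits.BirchSwinnertonDyer.BirchSwinnertonDyer.Theorems.EisensteinPrimesAcTwistDeformationCofreeRank
import Summits.BirchSwinnertonDyer.BirchSwinnertonDyer.Theorems.SignedBaseChangeAnticyclotomicEisensteinDivisibilityTwistDeformationLOC1
import HarnessLib

/-!
# Route `EisensteinPrimes` (rung K5), crux 2 `GoodLatticeBDPValue`, line `halves` v19.1, V21 index road
# input S2 (SUR_f at `v̄`) — the arena, part 4: `h⁰ = 0` and LOC⁽¹⁾ for the one-variable twist deformation
# of a NON-SCALAR `ρ₀` whose elements satisfy a monic QUADRATIC (Cayley–Hamilton shape, e.g. `E[p^∞]`)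
# (helper for stmt-BirchSwinnertonDyer-19032)

Cell `bsd-eis` (home `run/shared/lean/pub/bsd-eis/`), seat `bsd-line-x1-p1-w3` gen 3 (D-0154 width seat
on crux 2 `GoodLatticeBDPValue`, line `halves` v19.1; LEAD g4's V21 index road §4 S2/S4, curve side).
The corank-`n` SUR / squeeze file (`…AcTwistDeformationSURRank`) takes as HYPOTHESES the two inputs which
LEAD g2's road (A) obtained from the SCALAR action of a character: `corank H⁰ = 0` (globally and at the
places of `S`) and LOC_v⁽¹⁾. For `A = E[p^∞]` the action `ρ₀` is not scalar, but every `B = ρ₀(g)`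
satisfies a monic quadratic `B² = t·B − d` on `A` (`t = tr`, `d = det`, Cayley–Hamilton on `T_pE ≅ ℤ_p²`).
THIS FILE derives both inputs from such a relation at ONE element `g` with `κ(g) ≠ 0` (cell `bsd-ssimc`'s
`SignedBaseChangeAcDivTwistLOC1` / `…Determinant` do the same for the TWO-variable `Ind_{K̃_∞/K}` and ANY `ρ₀` by
determinants; the one-variable `bigRep` with a quadratic relation is lighter and is what `E[p^∞]` needs):

* §1 `C_mul_groupLike_quadratic_ne_zero` — in the domain `Λ = ℤ_p⟦T⟧`, for `u = γ^c` (`groupLike c`,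
  `c ≠ 0`): `d·u² − t·w·u + w² ≠ 0` whenever `w ≠ 0 ∨ d ≠ 0` (substitute `u = 1 + x`, `x ∈ (T) ∖ 0`, and
  read constant coefficients twice).
* §2 `bigRep_eq_mapRange_smul` — `g` acts on `𝐃 = A ⊗ Λ^*(κ⁻¹)` as `B̃ ∘ (u • ·)`, `B̃ = mapRange (ρ₀ g)`
  (pointwise), `u = γ^{-κ(g)}`; `mapRange_mapRange_of_quadratic` — `B̃² = t·B̃ − d`; hence
  **`quadratic_smul_eq_zero_of_bigRep_eq`**: `g·Φ = Φ ⟹ (d·u² − t·u + 1)·Φ = 0`.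
* §3 **`hasCorank_H0_bigRep_zero_of_quadratic`**, **`hasCorank_localH0_bigRep_zero_of_quadratic`** (via cell
  `bsd-ssimc`'s generic `SignedBaseChangeAcDivTwistLOC1.hasCorank_H0_zero_of_forall_fixed_smul_eq_zero`:
  `H⁰(G, 𝐃) = 𝐃^G` killed by a non-zero scalar has corank `0`).
* §4 **`bigRep_LOC1_of_quadratic`** — LOC_v⁽¹⁾(`𝐃`): with a Tate dual basis `j : Fin n → Hom(A, K̄ˣ)` on
  which `σ ∈ Γ_{K_v}` acts by a scalar `w` (the cyclotomic character), `ρ₀(σ̄)² = t ρ₀(σ̄) − d` with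
  `d ≠ 0`, and `κ(σ̄) ≠ 0`, every `Γ_{K_v}`-equivariant additive `f : 𝐃 → K̄ˣ` vanishes: `f = μ F` (moment
  pairing of `…CofreeRank`), `f ∘ B̃ = μ F₁`, `f ∘ B̃² = μ F₂`; equivariance of `f` and of `f ∘ B̃` plus the
  quadratic give `u·F₁ = w·F`, `u·F₂ = w·F₁`, `F₂ = t·F₁ − d·F`, whence `(d u² − t w u + w²)·F = 0`, `F = 0`.

Elementary and unconditional; THEOREMS ONLY; no named fact, no `sorry`. HONEST FRAMING: generic algebra
of the arena; closes nothing by itself (`--supports`); no summit statement / BSD / IMC2 / KY Thm. 1.4.1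
(iii) is proved by this file. References: [Greenberg2010] Lemma 5.2.2 (PDF p. 28); [Greenberg2016Selmer]
§2.1 p. 6, §4.3 p. 20 L26–30 ("LOC_η⁽¹⁾(𝒟) … holds for any prime η which does not split completely in
`K_∞/K`"); [Greenberg2006] Props. 4.1–4.2 (the terms `corank H⁰`).
-/

set_option autoImplicit false
set_option linter.dupNamespace false

noncomputable section

open scoped Classical
open Finset PowerSeries IsLocalRing NumberField IsDedekindDomain Field Multiplicative
open Literature.NumberTheory.EllipticCurves Literature.NumberTheory.IwasawaTheory
  Literature.NumberTheory.IwasawaTheory.Greenberg2016 Literature.NumberTheory.IwasawaTheory.Greenberg2006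
  Literature.NumberTheory.GaloisRepresentations
  Summit.BirchSwinnertonDyer.BirchSwinnertonDyer.Theorems.TwistDeformationCofree
  Summit.BirchSwinnertonDyer.BirchSwinnertonDyer.Theorems.GreenbergFullAtSelmer

namespace Summit.BirchSwinnertonDyer.BirchSwinnertonDyer.Theorems.AcTwistDeformation

/-! ## §1 The quadratic in a group-like element does not vanish -/

section Algebra

variable {p : ℕ} [Fact p.Prime]

/-- **`d·γ^{2c} − t w·γ^{c} + w² ≠ 0` in `Λ = ℤ_p⟦T⟧`** for `c ≠ 0` and `w ≠ 0 ∨ d ≠ 0`: with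
`x = γ^c − 1 ∈ (T)`, `x ≠ 0` (its linear coefficient is `c`), the element is
`d x² + (2d − tw) x + (w² − tw + d)`; were it `0`, the constant coefficients would give `w² − tw + d = 0`,
then `x (d x + (2d − tw)) = 0` forces `2d = tw` and `d x = 0`, i.e. `d = 0`, `tw = 0`, `w² = 0`.
[cite: Greenberg2010, Lemma 5.2.2 (PDF p. 28 L20–21)] -/
theorem C_mul_groupLike_quadratic_ne_zero {c : ℤ_[p]} (hc : c ≠ 0) (w t d : ℤ_[p]) (h : w ≠ 0 ∨ d ≠ 0) :
    PowerSeries.C d * groupLike ℤ_[p] c * groupLike ℤ_[p] c -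
        PowerSeries.C t * PowerSeries.C w * groupLike ℤ_[p] c + PowerSeries.C w * PowerSeries.C w ≠ 0 := by
  set u : PowerSeries ℤ_[p] := groupLike ℤ_[p] c with hu
  set x : PowerSeries ℤ_[p] := u - 1 with hx
  have hx0 : constantCoeff x = 0 := by
    rw [hx, map_sub, map_one, ← coeff_zero_eq_constantCoeff_apply, hu, coeff_zero_groupLike, sub_self]
  have hxne : x ≠ 0 := fun h0 ↦ by
    have h1 := congrArg (coeff 1) h0
    rw [hx, map_sub, hu, coeff_one_groupLike, Algebra.algebraMap_self, RingHom.id_apply, coeff_one,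
      if_neg one_ne_zero, sub_zero, map_zero] at h1
    exact hc h1
  intro hθ
  have hid : PowerSeries.C d * u * u - PowerSeries.C t * PowerSeries.C w * u + PowerSeries.C w * PowerSeries.C w =
      x * (PowerSeries.C d * x + (2 * PowerSeries.C d - PowerSeries.C t * PowerSeries.C w)) +
        (PowerSeries.C w * PowerSeries.C w - PowerSeries.C t * PowerSeries.C w + PowerSeries.C d) := by
    rw [hx]; ring
  rw [hid] at hθ
  -- constant coefficients: `w² − tw + d = 0`
  have h0 := congrArg constantCoeff hθ
  rw [map_add, map_mul, hx0, zero_mul, zero_add, map_add, map_sub, map_mul, map_mul, constantCoeff_C,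
    constantCoeff_C, constantCoeff_C, map_zero] at h0
  have hC0 : PowerSeries.C w * PowerSeries.C w - PowerSeries.C t * PowerSeries.C w + PowerSeries.C d =
      (0 : PowerSeries ℤ_[p]) := by
    rw [← map_mul, ← map_mul, ← map_sub, ← map_add, h0, map_zero]
  rw [hC0, add_zero] at hθ
  -- `x ≠ 0`: the other factor vanishes
  have h1 := (mul_eq_zero.mp hθ).resolve_left hxne
  have h1c := congrArg constantCoeff h1
  rw [map_add, map_mul, hx0, mul_zero, zero_add, map_sub, map_mul, map_mul, constantCoeff_C, constantCoeff_C,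
    constantCoeff_C, map_ofNat, map_zero] at h1c
  -- `2d = tw`, hence `d x = 0`, `d = 0`
  have h2 : (2 * PowerSeries.C d - PowerSeries.C t * PowerSeries.C w : PowerSeries ℤ_[p]) = 0 := by
    rw [← map_ofNat PowerSeries.C 2, ← map_mul, ← map_mul, ← map_sub, h1c, map_zero]
  rw [h2, add_zero] at h1
  have hd : d = 0 := by
    rcases mul_eq_zero.mp h1 with h3 | h3
    · simpa using congrArg constantCoeff h3
    · exact absurd h3 hxne
  -- `tw = 0`, `w² = 0`
  have htw : t * w = 0 := by
    have : (2 : ℤ_[p]) * d - t * w = 0 := h1c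
    rw [hd, mul_zero, zero_sub, neg_eq_zero] at this
    exact this
  have hw : w = 0 := by
    have : w * w - t * w + d = 0 := h0
    rw [htw, hd, sub_zero, add_zero] at this
    exact pow_eq_zero_iff (n := 2) two_ne_zero |>.mp (by rw [pow_two]; exact this)
  rcases h with h | h
  · exact h hw
  · exact h hd

end Algebra

/-! ## §2 The action of `g` on `𝐃` through `mapRange (ρ₀ g)` and the quadratic killer -/

section Quadratic

variable {K : Type} [Field K] [NumberField K] (S : Set (HeightOneSpectrum (𝓞 K))) {p : ℕ} [Fact p.Prime]
  {A : Type} [AddCommGroup A] [Module ℤ_[p] A] [TopologicalSpace A] [DiscreteTopology A]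
  [TopologicalSpace (PowerSeries ℤ_[p])]
  (hS : ∀ v : HeightOneSpectrum (𝓞 K), ((p : ℕ) : 𝓞 K) ∈ v.asIdeal → v ∈ S)
  (κ : ZpExtension K p) (ρ₀ : ContinuousRep (GaloisGroupUnramifiedOutside K S) ℤ_[p] A)

/-- **`g ∈ G_{K,S}` acts on `𝐃 = A ⊗ Λ^*(κ⁻¹)` as `B̃ ∘ γ^{-κ g}`**: `(g · Φ)(x) = ρ₀(g)(Φ(x − κ g))`, i.e.
`g · Φ = mapRange (ρ₀ g) (γ^{-κ g} • Φ)` (translations are the group-like elements,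
`translate_eq_groupLike_smul`). [cite: Greenberg2006, p. 342 L1–11 (ρ = ρ₀ ⊗ κ^{-1})] -/
theorem bigRep_eq_mapRange_smul (g : GaloisGroupUnramifiedOutside K S) (Φ : BigRepModule ℤ_[p] p A) :
    bigRep (κ.liftUnramifiedOutside S hS) ρ₀ g Φ =
      BigRepModule.mapRange (ρ₀ g)
        (groupLike ℤ_[p] (-(κ.liftUnramifiedOutside S hS g).toAdd) • Φ) := by
  ext x
  rw [bigRep_apply_apply, BigRepModule.mapRange_apply, ← translate_eq_groupLike_smul,
    BigRepModule.translate_apply, sub_eq_add_neg]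

omit [TopologicalSpace A] [DiscreteTopology A] [TopologicalSpace (PowerSeries ℤ_[p])] in
/-- **`B̃² = t·B̃ − d` on `𝐃`** when `B² = t·B − d` on `A` (`B̃ = mapRange B` acts pointwise).
[cite: Greenberg2016Selmer, §4.3 p. 20 L10–18 (T free of rank n, 𝒯 = T ⊗ κ)] -/
theorem mapRange_mapRange_of_quadratic (B : A →ₗ[ℤ_[p]] A) {t d : ℤ_[p]}
    (hquad : ∀ a : A, B (B a) = t • B a - d • a) (Ψ : BigRepModule ℤ_[p] p A) :
    BigRepModule.mapRange B (BigRepModule.mapRange B Ψ) =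
      PowerSeries.C t • BigRepModule.mapRange B Ψ - PowerSeries.C d • Ψ := by
  ext x
  rw [BigRepModule.mapRange_apply, BigRepModule.mapRange_apply, hquad, BigRepModule.sub_apply,
    BigRepModule.C_smul, BigRepModule.C_smul, BigRepModule.smul_apply, BigRepModule.smul_apply,
    BigRepModule.mapRange_apply]

/-- **THE QUADRATIC KILLER**: if `ρ₀(g)² = t·ρ₀(g) − d` on `A` and `g · Φ = Φ` in `𝐃`, then
`(d·u² − t·u + 1) • Φ = 0` with `u = γ^{-κ g}`: from `Φ = B̃(uΦ)` twice, `Φ = B̃²(u²Φ) = t·B̃(u²Φ) − d·u²Φ =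
t·uΦ − d·u²Φ`. [cite: Greenberg2010, Lemma 5.2.2 (PDF p. 28)] [cite: Greenberg2006, Prop. 4.1 (§4 A, p. 367: the term corank H⁰)] -/
theorem quadratic_smul_eq_zero_of_bigRep_eq (g : GaloisGroupUnramifiedOutside K S) {t d : ℤ_[p]}
    (hquad : ∀ a : A, ρ₀ g (ρ₀ g a) = t • ρ₀ g a - d • a) {Φ : BigRepModule ℤ_[p] p A}
    (hfix : bigRep (κ.liftUnramifiedOutside S hS) ρ₀ g Φ = Φ) :
    (PowerSeries.C d * groupLike ℤ_[p] (-(κ.liftUnramifiedOutside S hS g).toAdd) *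
          groupLike ℤ_[p] (-(κ.liftUnramifiedOutside S hS g).toAdd) -
        PowerSeries.C t * groupLike ℤ_[p] (-(κ.liftUnramifiedOutside S hS g).toAdd) + 1) • Φ = 0 := by
  set u : PowerSeries ℤ_[p] := groupLike ℤ_[p] (-(κ.liftUnramifiedOutside S hS g).toAdd) with hu
  set M : BigRepModule ℤ_[p] p A →ₗ[PowerSeries ℤ_[p]] BigRepModule ℤ_[p] p A :=
    BigRepModule.mapRangeₗ (ρ₀ g) with hM
  have hMapply : ∀ Ψ, M Ψ = BigRepModule.mapRange (ρ₀ g) Ψ := fun Ψ ↦ rfl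
  have h1 : M (u • Φ) = Φ := by rw [hMapply, hu, ← bigRep_eq_mapRange_smul S hS κ ρ₀ g Φ, hfix]
  have hMM : ∀ Ψ, M (M Ψ) = PowerSeries.C t • M Ψ - PowerSeries.C d • Ψ := fun Ψ ↦ by
    rw [hMapply, hMapply, mapRange_mapRange_of_quadratic (ρ₀ g) hquad]
  -- `Φ = B̃²(u²Φ) = t • uΦ − d • u²Φ`
  have e1 : M (u • (u • Φ)) = u • Φ := by rw [map_smul, h1]
  have e2 : M (M (u • (u • Φ))) = Φ := by rw [e1, h1]
  rw [hMM, e1] at e2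
  calc (PowerSeries.C d * u * u - PowerSeries.C t * u + 1) • Φ
      = PowerSeries.C d • (u • (u • Φ)) - PowerSeries.C t • (u • Φ) + Φ := by
        rw [add_smul, sub_smul, one_smul, mul_smul, mul_smul, mul_smul]
    _ = PowerSeries.C d • (u • (u • Φ)) - PowerSeries.C t • (u • Φ) +
          (PowerSeries.C t • (u • Φ) - PowerSeries.C d • (u • (u • Φ))) := by rw [e2]
    _ = 0 := by abel

end Quadratic

/-! ## §3 `corank H⁰ = 0`, globally and locally -/


section H0

variable {K : Type} [Field K] [NumberField K] (S : Set (HeightOneSpectrum (𝓞 K))) {p : ℕ} [Fact p.Prime]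
  {A : Type} [AddCommGroup A] [Module ℤ_[p] A] [TopologicalSpace A] [DiscreteTopology A]
  [TopologicalSpace (PowerSeries ℤ_[p])] [IsTopologicalAddGroup (BigRepModule ℤ_[p] p A)]
  [ContinuousSMul (PowerSeries ℤ_[p]) (BigRepModule ℤ_[p] p A)]
  (hS : ∀ v : HeightOneSpectrum (𝓞 K), ((p : ℕ) : 𝓞 K) ∈ v.asIdeal → v ∈ S)
  (κ : ZpExtension K p) (ρ₀ : ContinuousRep (GaloisGroupUnramifiedOutside K S) ℤ_[p] A)

omit [TopologicalSpace A] [DiscreteTopology A] [TopologicalSpace (PowerSeries ℤ_[p])]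
  [IsTopologicalAddGroup (BigRepModule ℤ_[p] p A)] [ContinuousSMul (PowerSeries ℤ_[p]) (BigRepModule ℤ_[p] p A)] in
/-- The killer `d·u² − t·u + 1` of §2 is non-zero for `u = γ^c`, `c ≠ 0` (§1 with `w = 1`).
[cite: Greenberg2010, Lemma 5.2.2 (PDF p. 28 L20–21)] -/
theorem quadratic_killer_ne_zero {c : ℤ_[p]} (hc : c ≠ 0) (t d : ℤ_[p]) :
    PowerSeries.C d * groupLike ℤ_[p] c * groupLike ℤ_[p] c - PowerSeries.C t * groupLike ℤ_[p] c + 1 ≠ 0 := by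
  have h := C_mul_groupLike_quadratic_ne_zero hc 1 t d (Or.inl one_ne_zero)
  rwa [map_one, mul_one, mul_one] at h

/-- **`corank_Λ H⁰(K_Σ/K, 𝐃) = 0`** for the one-variable twist deformation of an `A` on which some
`g ∈ G_{K,S}` with `κ(g) ≠ 0` (e.g. a topological generator) acts through `ρ₀(g)` satisfying a monic
quadratic `ρ₀(g)² = t·ρ₀(g) − d`. [cite: Greenberg2006, Prop. 4.1 (§4 A, p. 367: the term corank H⁰)] -/
theorem hasCorank_H0_bigRep_zero_of_quadratic (g : GaloisGroupUnramifiedOutside K S) {t d : ℤ_[p]}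
    (hquad : ∀ a : A, ρ₀ g (ρ₀ g a) = t • ρ₀ g a - d • a)
    (hg : κ.liftUnramifiedOutside S hS g ≠ 1) :
    HasCorank (PowerSeries ℤ_[p]) ((bigRep (κ.liftUnramifiedOutside S hS) ρ₀).H 0) 0 := by
  have hc : -(κ.liftUnramifiedOutside S hS g).toAdd ≠ 0 :=
    neg_ne_zero.mpr fun h0 ↦ hg (toAdd_eq_zero.mp h0)
  exact SignedBaseChangeAcDivTwistLOC1.hasCorank_H0_zero_of_forall_fixed_smul_eq_zero _ g (quadratic_killer_ne_zero hc t d)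
    fun Φ hΦ ↦ quadratic_smul_eq_zero_of_bigRep_eq S hS κ ρ₀ g hquad hΦ

/-- **`corank_Λ H⁰(K_v, 𝐃) = 0`** at a place `v` with an element `σ ∈ Γ_{K_v}` of non-trivial image in
`Γ = Gal(K_∞/K)` whose `ρ₀(σ̄)` satisfies a monic quadratic. [cite: Greenberg2006, Prop. 4.2 (§4 A, p. 368: the term corank H⁰)] -/
theorem hasCorank_localH0_bigRep_zero_of_quadratic (v : Place K) (σ : absoluteGaloisGroup v.Completion)
    {t d : ℤ_[p]}
    (hquad : ∀ a : A, ρ₀ (localToUnramified S v σ) (ρ₀ (localToUnramified S v σ) a) =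
      t • ρ₀ (localToUnramified S v σ) a - d • a)
    (hσ : κ (absGaloisRestrict K v.Completion σ) ≠ 1) :
    HasCorank (PowerSeries ℤ_[p]) ((localRep S (bigRep (κ.liftUnramifiedOutside S hS) ρ₀) v).H 0) 0 := by
  have hg : κ.liftUnramifiedOutside S hS (localToUnramified S v σ) ≠ 1 := hσ
  have hc : -(κ.liftUnramifiedOutside S hS (localToUnramified S v σ)).toAdd ≠ 0 :=
    neg_ne_zero.mpr fun h0 ↦ hg (toAdd_eq_zero.mp h0)
  refine SignedBaseChangeAcDivTwistLOC1.hasCorank_H0_zero_of_forall_fixed_smul_eq_zero _ σ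
    (quadratic_killer_ne_zero hc t d) fun Φ hΦ ↦ ?_
  rw [localRep_apply] at hΦ
  exact quadratic_smul_eq_zero_of_bigRep_eq S hS κ ρ₀ _ hquad hΦ

end H0

/-! ## §4 LOC⁽¹⁾ for a non-scalar `ρ₀` with a quadratic relation -/

section LOC1Rank

variable {K : Type} [Field K] [NumberField K] (S : Set (HeightOneSpectrum (𝓞 K))) {p : ℕ} [Fact p.Prime]
  {A : Type} [AddCommGroup A] [Module ℤ_[p] A] [TopologicalSpace A] [DiscreteTopology A]
  [TopologicalSpace (PowerSeries ℤ_[p])]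
  (hS : ∀ v : HeightOneSpectrum (𝓞 K), ((p : ℕ) : 𝓞 K) ∈ v.asIdeal → v ∈ S)
  (κ : ZpExtension K p) (ρ₀ : ContinuousRep (GaloisGroupUnramifiedOutside K S) ℤ_[p] A) {n : ℕ}

omit [TopologicalSpace A] [DiscreteTopology A] [TopologicalSpace (PowerSeries ℤ_[p])] in
/-- The moment pairing intertwines the `Λ`-action on `𝐃` with the `Λ`-action on `Λⁿ`:
`μ G (r • Φ) = μ (r • G) Φ`. [cite: Greenberg2006, p. 342 L5–11] -/
theorem momentPairing_pi_smul {C : Type*} [AddCommGroup C] (jC : Fin n → (A →+ C))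
    {μ : (Fin n → PowerSeries ℤ_[p]) →+ (BigRepModule ℤ_[p] p A →+ C)}
    (hμ : ∀ (F : Fin n → PowerSeries ℤ_[p]) (Φ : BigRepModule ℤ_[p] p A), μ F Φ = ∑ k, jC k ((F k • Φ) 0))
    (G : Fin n → PowerSeries ℤ_[p]) (r : PowerSeries ℤ_[p]) (Φ : BigRepModule ℤ_[p] p A) :
    μ G (r • Φ) = μ (r • G) Φ := by
  rw [hμ, hμ]
  exact Finset.sum_congr rfl fun k _ ↦ by rw [← mul_smul, Pi.smul_apply, smul_eq_mul, mul_comm]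

/-- **LOC_v⁽¹⁾(`𝐃`) for a NON-SCALAR `ρ₀` with a quadratic relation** ([Greenberg2010] Lemma 5.2.2 shape:
"LOC_η⁽¹⁾(𝒟) holds for any prime `η` which does not split completely in `K_∞/K`"): `A` `p`-primary with a
Tate dual basis `j : Fin n → Hom(A, K̄ˣ)` (`ℤ_pⁿ ≅ Hom(A, K̄ˣ)`) on which `σ ∈ Γ_{K_v}` acts by ONE scalar
`w` (the cyclotomic character), `ρ₀(σ̄)² = t·ρ₀(σ̄) − d` on `A` with `d ≠ 0` (`d = det`), and `κ(σ̄) ≠ 0`.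
Then every `Γ_{K_v}`-equivariant additive `f : 𝐃 → K̄ˣ` vanishes: `f = μ F`, `f ∘ B̃ = μ F₁`, `f ∘ B̃² = μ F₂`
(moment pairing onto), equivariance of `f` and of `f ∘ B̃` read `u·F₁ = w·F`, `u·F₂ = w·F₁` (injectivity),
the quadratic reads `F₂ = t·F₁ − d·F`; hence `(d u² − t w u + w²)·F = 0` in `Λⁿ`, and the scalar is
non-zero (§1). [cite: Greenberg2010, Lemma 5.2.2 (PDF p. 28 L20–21)] [cite: Greenberg2016Selmer, §4.3 p. 20 L26–30] -/
theorem bigRep_LOC1_of_quadratic (hA : ∀ a : A, ∃ k : ℕ, p ^ k • a = 0)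
    (jU : Fin n → (A →+ DiscreteGaloisModule.UnitsCarrier K))
    (hinj : ∀ c : Fin n → ℤ_[p], (∀ a : A, ∑ k, jU k (c k • a) = 0) → c = 0)
    (hsurj : ∀ φ : A →+ DiscreteGaloisModule.UnitsCarrier K, ∃ c : Fin n → ℤ_[p], ∀ a : A,
      φ a = ∑ k, jU k (c k • a))
    (v : Place K) (σ : absoluteGaloisGroup v.Completion) {t d w : ℤ_[p]}
    (hquad : ∀ a : A, ρ₀ (localToUnramified S v σ) (ρ₀ (localToUnramified S v σ) a) =
      t • ρ₀ (localToUnramified S v σ) a - d • a)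
    (hd : d ≠ 0)
    (hw : ∀ (k : Fin n) (a : A),
      DiscreteGaloisModule.units K (absGaloisRestrict K v.Completion σ) (jU k a) = jU k (w • a))
    (hσ : κ (absGaloisRestrict K v.Completion σ) ≠ 1) :
    LOC1 S (bigRep (κ.liftUnramifiedOutside S hS) ρ₀) v := by
  intro f hf
  obtain ⟨μ, hμ⟩ := exists_momentPairing_pi (p := p) (A := A) jU
  have hμinj := momentPairing_pi_injective jU hA hinj hμ
  have hμsurj := momentPairing_pi_surjective jU hA hsurj hμ
  set g := localToUnramified S v σ with hgdef
  have hg : κ.liftUnramifiedOutside S hS g ≠ 1 := hσ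
  have hc : -(κ.liftUnramifiedOutside S hS g).toAdd ≠ 0 := neg_ne_zero.mpr fun h0 ↦ hg (toAdd_eq_zero.mp h0)
  set u : PowerSeries ℤ_[p] := groupLike ℤ_[p] (-(κ.liftUnramifiedOutside S hS g).toAdd) with hu
  set M : BigRepModule ℤ_[p] p A →ₗ[PowerSeries ℤ_[p]] BigRepModule ℤ_[p] p A :=
    BigRepModule.mapRangeₗ (ρ₀ g) with hM
  have hMapply : ∀ Ψ, M Ψ = BigRepModule.mapRange (ρ₀ g) Ψ := fun Ψ ↦ rfl
  -- the action of `σ`: `σ · Φ = M (u • Φ)`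
  have hact : ∀ Φ : BigRepModule ℤ_[p] p A,
      localRep S (bigRep (κ.liftUnramifiedOutside S hS) ρ₀) v σ Φ = M (u • Φ) := fun Φ ↦ by
    rw [localRep_apply, bigRep_eq_mapRange_smul S hS κ ρ₀, hMapply]
  have hMM : ∀ Ψ, M (M Ψ) = PowerSeries.C t • M Ψ - PowerSeries.C d • Ψ := fun Ψ ↦ by
    rw [hMapply, hMapply, mapRange_mapRange_of_quadratic (ρ₀ g) hquad]
  -- `U ∘ μ G = μ (w • G)`
  have hU : ∀ (G : Fin n → PowerSeries ℤ_[p]) (Φ : BigRepModule ℤ_[p] p A),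
      DiscreteGaloisModule.units K (absGaloisRestrict K v.Completion σ) (μ G Φ) = μ (PowerSeries.C w • G) Φ := by
    intro G Φ
    rw [hμ, hμ, map_sum]
    refine Finset.sum_congr rfl fun k _ ↦ ?_
    rw [hw, Pi.smul_apply, smul_eq_mul, mul_smul, BigRepModule.C_smul, BigRepModule.smul_apply]
  -- `f = μ F`, `f ∘ M = μ F₁`, `f ∘ M² = μ F₂`
  obtain ⟨F, hF⟩ := hμsurj f
  obtain ⟨F₁, hF₁⟩ := hμsurj (f.comp M.toAddMonoidHom)
  obtain ⟨F₂, hF₂⟩ := hμsurj ((f.comp M.toAddMonoidHom).comp M.toAddMonoidHom)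
  -- (E1) equivariance of `f`: `u • F₁ = w • F`
  have hE1 : u • F₁ = PowerSeries.C w • F := by
    apply hμinj
    ext Φ
    have e := hf σ Φ
    rw [hact] at e
    rw [← momentPairing_pi_smul jU hμ, hF₁, ← hU, hF]
    simpa only [AddMonoidHom.comp_apply, LinearMap.toAddMonoidHom_coe] using e
  -- (E2) equivariance of `f ∘ B̃`: `u • F₂ = w • F₁`
  have hE2 : u • F₂ = PowerSeries.C w • F₁ := by
    apply hμinj
    ext Ψ
    have e := hf σ (M Ψ)
    rw [hact, ← map_smul] at e
    rw [← momentPairing_pi_smul jU hμ, hF₂, ← hU, hF₁]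
    simpa only [AddMonoidHom.comp_apply, LinearMap.toAddMonoidHom_coe] using e
  -- (E3) the quadratic: `F₂ = t • F₁ − d • F`
  have hE3 : F₂ = PowerSeries.C t • F₁ - PowerSeries.C d • F := by
    apply hμinj
    ext Ξ
    rw [map_sub μ, AddMonoidHom.sub_apply, ← momentPairing_pi_smul jU hμ F₁, ← momentPairing_pi_smul jU hμ F,
      hF₂, hF₁, hF]
    simp only [AddMonoidHom.comp_apply, LinearMap.toAddMonoidHom_coe]
    rw [hMM, map_sub f, map_smul M]
  -- componentwise: `(d u² − t w u + w²) · F k = 0`, the scalar is non-zero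
  have hθ := C_mul_groupLike_quadratic_ne_zero hc w t d (Or.inr hd)
  have hF0 : F = 0 := by
    funext k
    have e1 : u * F₁ k = PowerSeries.C w * F k := by
      simpa only [Pi.smul_apply, smul_eq_mul] using congrFun hE1 k
    have e2 : u * F₂ k = PowerSeries.C w * F₁ k := by
      simpa only [Pi.smul_apply, smul_eq_mul] using congrFun hE2 k
    have e3 : F₂ k = PowerSeries.C t * F₁ k - PowerSeries.C d * F k := by
      simpa only [Pi.smul_apply, Pi.sub_apply, smul_eq_mul] using congrFun hE3 k
    have key : (PowerSeries.C d * u * u - PowerSeries.C t * PowerSeries.C w * u +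
        PowerSeries.C w * PowerSeries.C w) * F k = 0 := by
      linear_combination (PowerSeries.C t * u - PowerSeries.C w) * e1 + (-u) * e2 + (u * u) * e3
    exact (mul_eq_zero.mp key).resolve_left hθ
  rw [← hF, hF0, map_zero]

end LOC1Rank

end Summit.BirchSwinnertonDyer.BirchSwinnertonDyer.Theorems.AcTwistDeformation

end
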